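import Summits.BirchSwinnertonDyer.BirchSwinnertonDyer.Theorems.SignedLowerHalvesKobayashiMainConjectureSmallImageTeichSpanHecke
import Summits.BirchSwinnertonDyer.Rank1Residual.GaloisImage.NonsplitCartanDictionary
import Literature.NumberTheory.EllipticCurves.PAdicLFunctionBranchMuCertificateProofs
import HarnessLib

/-!
# Route `SignedLowerHalves` (K3), crux M `SmallImageMuZeroOneSign` (item stmt-BirchSwinnertonDyer-23600), line `birth_mu` v2,
# open stub `stub_muAnOneSignGeFive_ns` (= retired 23117 `SmallImageOneSignUnitContent` VERBATIM):
# **the SUPERSINGULAR even-branch μ-floor, INPUT-FREE, and the {5, 7, 11} cut in branch currency**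
# (cell `bsd-ssimc`, width seat `bsd-line-slh-p3-w3` gen 2, director-bsd (323)(3)(a); `--supports 23600`; THEOREMS ONLY)

HONEST FRAMING.  The stub (one-signed Perrin-Riou / Pollack: at every small-image X7 pair with `p ≥ 5`, for the
conductor-level newform, SOME sign has a signed `p`-adic `L`-function with a unit coefficient) is NOT proved here and
stays OPEN; crux M, crux 4 and BSD are not proved by any of this.  What this file PROVES, with no named fact, no stub
and no hypothesis beyond the curve data, is the supersingular twin of the tree's ordinary (`EvenBranch.evenBranchMuZero`,
`…PrintX9EvenBranchMuZeroInputFree`) and multiplicative (`X11aLowerHalfBranchDichotomy.branchZero_or_branchTwo_five_of_mult`)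
even-branch theorems — the corner X7 / small image was the one corner of the cell without it:

* §1 `exists_even_weightedOrbitSum_norm_eq_one_of_unit` (level form, any rational newform `f` on `Γ₀(N)`, `p` odd,
  `p ∤ N`, `a_p(f) = 0`): ONE unit plus symbol `[u/p^{n+1}]⁺_f` (`u` a unit) forces, at the same level, a
  Teichmüller-orbit sum WEIGHTED BY AN EVEN POWER `η^i` (`i < p − 1`, `i` even) of `p`-adic norm `1`:
  `‖Σ_η η^i [η γˢ/p^{n+1}]⁺_f‖_p = 1` — orthogonality of the tame characters over `μ_{p−1}(ℤ_p)`
  (`exists_lt_norm_branchOrbitSum_of_lt_norm_apply`, MTT §I.13) applied to the RAW plus-symbol family (no measure,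
  no `α`: the supersingular case has no bounded measure, but orthogonality is level-wise), evenness `[−r]⁺ = [r]⁺`
  killing the odd weights (`branchOrbitSum_eq_zero_of_odd`), `p`-integrality of `[·/p^m]⁺` (`SmallImageHeckePrimeMu`).
* §2 `exists_even_weightedOrbitSum_norm_eq_one_of_isNewformOf` — **INPUT-FREE, every elliptic curve over `ℚ` with good
  SUPERSINGULAR reduction at an odd prime `p` (`a_p = 0`) and its newform**: some even weight `i < p − 1` carries a unit
  weighted orbit sum at some level `≥ 1`.  Chain: `E[p]` irreducible (Serre Prop. 12 at a supersingular prime, tree) ⇒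
  winding non-constancy (`EvenBranch.cycWindingNonConstantAt_of_odd`, THEOREM B road on Vaserstein's theorem, tree) ⇒ a
  unit plus symbol at a unit residue (`SmallImageCycWindingMuThree.exists_unit_norm_ratPlusSymbol_eq_one_of_nonConstant`) ⇒ §1.
  In Mazur–Tate language: the layer-`n` element `θ_n(f) ∈ ℚ[(ℤ/p^{n+1})ˣ]` is `≢ 0 (mod p)` and, `f` being even, lives on the
  even tame components; SOME even component `e_{ω^i} θ_n(f)` is nonzero mod `p` — i.e. `μ(θ_n(f, ω^i)) = 0` for some even `i`.
* §3 `exists_sign_hasUnitContent_of_weightZero` — the weight `i = 0` is EXACTLY the cut's certificate: a unit `ω⁰`-orbit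
  sum is a unit `S_f(p, n+1, γˢ)` (`teichOrbitSum_eq_finsum`), hence a signed Pollack function with unit content
  (`SmallImageTeichSpanHecke.exists_sign_hasUnitContent_of_one_le_norm_teichOrbitSum`, p645198/p636207 chain).
  `exists_sign_hasUnitContent_or_pos_even_branch` — **THE DICHOTOMY per newform**: EITHER `∃ ε L, IsSignedPAdicLFunction f p ε L ∧
  HasUnitContent L` (`min(μ(L_p⁺), μ(L_p⁻)) = 0`, the stub's conclusion at the pair) OR some NON-TRIVIAL even weight
  `0 < i < p − 1` carries a unit weighted orbit sum; at `p = 5`: **`ω⁰ ∨ ω²`** (`…_or_weightTwo_five`: the only competitor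
  is the quadratic branch `ω² = (5/·)`); at `p = 7`: `ω⁰ ∨ ω² ∨ ω⁴`; at `p = 11`: `ω⁰ ∨ ω² ∨ ω⁴ ∨ ω⁶ ∨ ω⁸`.
* §4 class level (the director's «{5, 7, 11} cut», `SmallImageMuZeroOneSignOfFacts` §2's `h5711`):
  `stub_iff_le_eleven` — the registered stub (= retired 23117, VERBATIM text; route-independent) ⟺ its own restriction to
  `p ≤ 11`, GRANTED BDMTV 2019/2023 (`h13`, `h17`, published, by name) and non-split Serre uniformity at `p ≥ 19` (`h19`, OPEN)
  — PRINT-FREE (the M-version in `…OfFacts` §2 needs the five prints; the stub itself needs none: the domain is empty at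
  `13`, `17`, `≥ 19`); `cut_of_orbitUnit` — the cut ⟸ one unit `ω⁰`-orbit sum per pair (Conjecture-W shape, decidable per
  pair); `cut_or_pos_even_branch` — at every pair of the cut's domain the dichotomy of §3 holds UNCONDITIONALLY, so the
  cut's residual in branch currency is «no small-image pair at `p ∈ {5,7,11}` has ALL its unit orbit content on the
  non-trivial even branches» (at `p = 5`: on `ω²` alone).
HONEST SCOPE: nothing here separates `ω⁰` from `ω²` (that separation IS the one-signed Perrin-Riou conjecture on the class,
equivalently B⁰_ss at the conductor levels, `SmallImageTeichSpanHecke`); the census of transfer roads (this seat's memo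
`Lines/birth_mu-ROADS-w3g2.md` on the crux dir of 23600) records why no class-wide road reaches it.  beyond-print theorem: no
(MTT §I.13 bookkeeping on top of the tree's beyond-print winding theorem).  BSD is not proved by any of this.

References: [MazurTateTeitelbaum1986Invent] §I.8 (`[−r]⁺ = [r]⁺`), §I.10 (10.1), §I.13; [PollackWeston2011] Thm. 4.1 (1), Rem. 4.2;
[Pollack2003] Def. 6.15, Rem. 6.16, Conj. 6.3; [GreenbergVatsal2000] §3 Prop. (3.7); [Washington1997] §5.1, §7.2; [Serre1972] §1.11 Prop. 12;
[Vaserstein1972SL2] Theorem; [BalakrishnanEtAl2019] Cor. 1.3; [BalakrishnanEtAl2023] Thm. 1.2; [SerreKyoto1977] questions 6.5–6.6.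
-/

-- D-0017: single-problem summit, the namespace repeats the problem name by design.
set_option linter.dupNamespace false
set_option autoImplicit false

noncomputable section

open scoped Classical MatrixGroups ModularForm

open CongruenceSubgroup Literature.NumberTheory.EllipticCurves Literature.NumberTheory.EllipticCurves.ModularForms
  Literature.NumberTheory.EllipticCurves.Kobayashi2003 Literature.NumberTheory.EllipticCurves.GreenbergVatsal2000
  Literature.NumberTheory.EllipticCurves.Rank1Residual

namespace Summit.BirchSwinnertonDyer.BirchSwinnertonDyer.Theorems.SmallImageMuAnEvenBranch

open Summit.BirchSwinnertonDyer.BirchSwinnertonDyer.Theorems.SmallImageHeckePrimeMu (norm_ratPlusSymbol_intCast_div_pow_le_one)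
open Summit.BirchSwinnertonDyer.BirchSwinnertonDyer.Theorems.SmallImageCycWindingMuThree
  (exists_unit_norm_ratPlusSymbol_eq_one_of_nonConstant)
open Summit.BirchSwinnertonDyer.BirchSwinnertonDyer.Theorems.SmallImageTeichSpanHecke
  (exists_sign_hasUnitContent_of_one_le_norm_teichOrbitSum)
variable {N : ℕ} [NeZero N] (f : CuspForm (Gamma0 N) 2) {p : ℕ} [Fact p.Prime]

/-! ## §1 Level form: one unit plus symbol ⇒ a unit EVEN-weight Teichmüller orbit sum at the same level -/

/-- **The raw plus-symbol family is even**: `[(−b)/p^m]⁺_f = [b/p^m]⁺_f` for `b ∈ ℤ/p^m` (representatives in `[0, p^m)`):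
`(−b).val = p^m − b.val`, periodicity `[r + 1]⁺ = [r]⁺` and evenness `[−r]⁺ = [r]⁺`.
[cite: MazurTateTeitelbaum1986Invent, §I.8 ([−r]⁺ = [r]⁺)] -/
theorem ratPlusSymbol_neg_val_div_pow (m : ℕ) (b : ZMod (p ^ m)) :
    ratPlusSymbol f ((((-b).val : ℕ) : ℚ) / (p : ℚ) ^ m) = ratPlusSymbol f (((b.val : ℕ) : ℚ) / (p : ℚ) ^ m) := by
  have hp : p.Prime := Fact.out
  by_cases hb : b = 0
  · subst hb; rw [neg_zero]
  haveI : NeZero (p ^ m) := ⟨pow_ne_zero _ hp.ne_zero⟩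
  have hval : (-b).val = p ^ m - b.val := by rw [ZMod.neg_val, if_neg hb]
  have hlt : b.val ≤ p ^ m := (ZMod.val_lt b).le
  have hcast : (((-b).val : ℕ) : ℚ) = (p : ℚ) ^ m - (b.val : ℚ) := by
    rw [hval, Nat.cast_sub hlt]; push_cast; ring
  have hp0 : (p : ℚ) ≠ 0 := by exact_mod_cast hp.ne_zero
  have e : (((-b).val : ℕ) : ℚ) / (p : ℚ) ^ m = -(((b.val : ℕ) : ℚ) / (p : ℚ) ^ m) + ((1 : ℤ) : ℚ) := by
    rw [hcast]; push_cast; field_simp; ring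
  rw [e, ratPlusSymbol_add_intCast_eq, ratPlusSymbol_neg]

/-- **One unit plus symbol ⇒ a unit even-weight orbit sum** (`p` odd, `p ∤ N`, `a_p(f) = 0`, `f` a normalised newform):
if `‖[u/p^{n+1}]⁺_f‖_p = 1` for a unit `u` of `ℤ/p^{n+1}`, then for some `s` and some EVEN `i < p − 1` the `η^i`-weighted
Teichmüller orbit sum `Σ_{η ∈ μ_{p−1}(ℤ_p)} η^i [η̄ γˢ/p^{n+1}]⁺_f` (`γ = 1 + p`) has `p`-adic norm `1`.  Proof: `u = η̄₀ γˢ`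
(`exists_coe_eq_toZModPow_mul_pow`); orthogonality of the `p − 1` tame characters gives a weight `i` with
`p⁻¹ < ‖Σ_η η^i [·]⁺‖` (`exists_lt_norm_branchOrbitSum_of_lt_norm_apply`, applied to the RAW plus-symbol family — level-wise,
no measure); odd weights vanish by evenness (`branchOrbitSum_eq_zero_of_odd`); integrality caps the norm at `1`, and
`p⁻¹ < ‖x‖ ≤ 1 ⇒ ‖x‖ = 1`.  [cite: MazurTateTeitelbaum1986Invent, §I.13] [cite: Washington1997, §5.1] -/
theorem exists_even_weightedOrbitSum_norm_eq_one_of_unit (hp2 : p ≠ 2) (hf0 : IsNewform0 f) (hpN : ¬ p ∣ N)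
    (hap : cuspCoeff f p = ((0 : ℤ) : ℂ)) {n : ℕ} (u : (ZMod (p ^ (n + 1)))ˣ)
    (hu : ‖((ratPlusSymbol f ((((u : ZMod (p ^ (n + 1))).val : ℕ) : ℚ) / (p : ℚ) ^ (n + 1)) : ℚ) : ℚ_[p])‖ = 1) :
    ∃ (s : ZMod (p ^ n)) (i : ℕ), i < p - 1 ∧ Even i ∧
      ‖∑ᶠ ξ : rootsOfUnity (torsionOrder p) ℤ_[p], (((ξ : ℤ_[p]ˣ) : ℤ_[p]) : ℚ_[p]) ^ i *
        ((ratPlusSymbol f ((((PadicInt.toZModPow (n + 1) ((ξ : ℤ_[p]ˣ) : ℤ_[p]) *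
          (cyclotomicGenerator p : ZMod (p ^ (n + 1))) ^ s.val).val : ℕ) : ℚ) / (p : ℚ) ^ (n + 1)) : ℚ) : ℚ_[p])‖ = 1 := by
  classical
  have hp : p.Prime := Fact.out
  haveI := neZero_torsionOrder p
  haveI := Fintype.ofFinite (rootsOfUnity (torsionOrder p) ℤ_[p])
  have he : cyclotomicExponent p = 1 := by rw [cyclotomicExponent, if_neg hp2]
  have hτ : torsionOrder p = p - 1 := by rw [torsionOrder_eq, if_neg hp2]
  -- the raw plus-symbol family on the `p`-power tower, read in `ℚ_p`
  set μ : (m : ℕ) → ZMod (p ^ m) → ℚ_[p] :=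
    fun m a ↦ ((ratPlusSymbol f (((a.val : ℕ) : ℚ) / (p : ℚ) ^ m) : ℚ) : ℚ_[p]) with hμ
  have hμle : ∀ (m : ℕ) (a : ZMod (p ^ m)), ‖μ m a‖ ≤ 1 := by
    intro m a
    have h := norm_ratPlusSymbol_intCast_div_pow_le_one f hp2 hf0 hpN hap ((a.val : ℕ) : ℤ) m
    rwa [Int.cast_natCast] at h
  have hμeven : ∀ (m : ℕ) (b : ZMod (p ^ m)), μ m (-b) = μ m b := by
    intro m b
    simp only [hμ, ratPlusSymbol_neg_val_div_pow]
  -- `u = η̄₀ γˢ`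
  obtain ⟨ξ₀, s, hus⟩ := exists_coe_eq_toZModPow_mul_pow hp2 n u
  -- the value at `u` beats `p⁻¹` (stated at level `n + e₀`, `e₀ = 1`)
  have hA : (1 : ℝ) * (p : ℝ)⁻¹ < ‖μ (n + cyclotomicExponent p)
      (PadicInt.toZModPow (n + cyclotomicExponent p) ((ξ₀ : ℤ_[p]ˣ) : ℤ_[p]) *
        (cyclotomicGenerator p : ZMod (p ^ (n + cyclotomicExponent p))) ^ s.val)‖ := by
    have key : ∀ k : ℕ, k = n + 1 → (1 : ℝ) * (p : ℝ)⁻¹ <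
        ‖μ k (PadicInt.toZModPow k ((ξ₀ : ℤ_[p]ˣ) : ℤ_[p]) * (cyclotomicGenerator p : ZMod (p ^ k)) ^ s.val)‖ := by
      rintro k rfl
      rw [← hus, hμ]
      dsimp only
      rw [hu, one_mul]
      exact inv_lt_one_of_one_lt₀ (by exact_mod_cast hp.one_lt)
    exact key _ (by rw [he])
  obtain ⟨i, hi, hνi⟩ := exists_lt_norm_branchOrbitSum_of_lt_norm_apply (μ := μ) hp2 ξ₀ s hA
  rw [one_mul] at hνi
  -- `i` is even: odd weights vanish on an even family
  have hieven : Even i := by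
    by_contra hodd
    rw [Nat.not_even_iff_odd] at hodd
    have h0 := branchOrbitSum_eq_zero_of_odd (μ := μ) hp2 (n := n) (hμeven _) hodd s
    rw [h0, norm_zero] at hνi
    exact absurd hνi (not_lt.mpr (by positivity))
  -- the weighted orbit sum is `p`-integral, hence a unit
  have hle : ‖∑ᶠ ξ : rootsOfUnity (torsionOrder p) ℤ_[p], (((ξ : ℤ_[p]ˣ) : ℤ_[p]) : ℚ_[p]) ^ i *
      μ (n + cyclotomicExponent p)
        (PadicInt.toZModPow (n + cyclotomicExponent p) ((ξ : ℤ_[p]ˣ) : ℤ_[p]) *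
          (cyclotomicGenerator p : ZMod (p ^ (n + cyclotomicExponent p))) ^ s.val)‖ ≤ 1 := by
    rw [finsum_eq_sum_of_fintype]
    refine IsUltrametricDist.norm_sum_le_of_forall_le_of_nonneg zero_le_one fun ξ _ ↦ ?_
    rw [norm_mul, norm_pow]
    calc _ ≤ (1 : ℝ) ^ i * 1 :=
          mul_le_mul (pow_le_pow_left₀ (norm_nonneg _) (PadicInt.norm_le_one _) i) (hμle _ _)
            (norm_nonneg _) (by positivity)
      _ = 1 := by rw [one_pow, one_mul]
  have hone := norm_eq_one_of_inv_lt_of_le_one hνi hle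
  refine ⟨s, i, hτ ▸ hi, hieven, ?_⟩
  have key : ∀ k : ℕ, k = n + cyclotomicExponent p →
      ‖∑ᶠ ξ : rootsOfUnity (torsionOrder p) ℤ_[p], (((ξ : ℤ_[p]ˣ) : ℤ_[p]) : ℚ_[p]) ^ i *
        μ k (PadicInt.toZModPow k ((ξ : ℤ_[p]ˣ) : ℤ_[p]) * (cyclotomicGenerator p : ZMod (p ^ k)) ^ s.val)‖ = 1 := by
    rintro k rfl
    exact hone
  have h := key (n + 1) (by rw [he])
  simpa only [hμ] using h

/-! ## §2 INPUT-FREE: every elliptic curve over `ℚ` with good supersingular reduction at an odd `p` (`a_p = 0`) -/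

/-- **The supersingular even-branch μ-floor, input-free.**  For `W/ℚ` globally minimal with good reduction at the odd prime `p`
and `a_p = 0`, and its newform `f` of level `N`: at some level `p^{n+1}`, some EVEN weight `i < p − 1` and some `s`, the
`η^i`-weighted Teichmüller orbit sum of plus symbols `Σ_η η^i [η̄ γˢ/p^{n+1}]⁺_f` is a `p`-adic unit — «SOME EVEN tame component
of the Mazur–Tate element `θ_n(f)` is nonzero mod `p`».  `E[p]` irreducible (Serre Prop. 12, supersingular) ⇒ winding
non-constancy (input-free THEOREM B road, `EvenBranch.cycWindingNonConstantAt_of_odd`) ⇒ a unit plus symbol at a unit residue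
(`SmallImageCycWindingMuThree`) ⇒ §1.  The supersingular twin of `EvenBranch.evenBranchMuZero` (good ordinary) and of
`X11aLowerHalfBranchDichotomy.exists_even_branch_norm_coeff_eq_one_of_mult` (multiplicative).
[cite: MazurTateTeitelbaum1986Invent, §I.10 (10.1), §I.13] [cite: Serre1972, §1.11 Prop. 12] [cite: Vaserstein1972SL2, Theorem] -/
theorem exists_even_weightedOrbitSum_norm_eq_one_of_isNewformOf {W : WeierstrassCurve ℚ} [W.IsElliptic]
    [W.IsGloballyMinimal] (hp2 : p ≠ 2) (hf : IsNewformOf W f) (hgood : W.HasGoodReductionAtPrime p)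
    (hap : W.frobeniusTrace p = 0) :
    ∃ (n : ℕ) (s : ZMod (p ^ n)) (i : ℕ), i < p - 1 ∧ Even i ∧
      ‖∑ᶠ ξ : rootsOfUnity (torsionOrder p) ℤ_[p], (((ξ : ℤ_[p]ˣ) : ℤ_[p]) : ℚ_[p]) ^ i *
        ((ratPlusSymbol f ((((PadicInt.toZModPow (n + 1) ((ξ : ℤ_[p]ˣ) : ℤ_[p]) *
          (cyclotomicGenerator p : ZMod (p ^ (n + 1))) ^ s.val).val : ℕ) : ℚ) / (p : ℚ) ^ (n + 1)) : ℚ) : ℚ_[p])‖ = 1 := by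
  have hpN : ¬ p ∣ N := not_dvd_level_of_isNewformOf hf hgood
  have hap' : cuspCoeff f p = ((0 : ℤ) : ℂ) := by
    rw [cuspCoeff_eq_frobeniusTrace_of_isNewformOf_holds hf hgood, hap]
  have hirr : W.HasIrreducibleModPGaloisRep p :=
    hasIrreducibleModPGaloisRep_of_dvd_frobeniusTrace W p hp2
      (W.not_dvd_minimalDiscriminantInt_of_hasGoodReductionAtPrime' p hgood) (by rw [hap]; exact dvd_zero _)
  have hnc : CycWindingNonConstantAt W p :=
    Summit.BirchSwinnertonDyer.BirchSwinnertonDyer.Rank1Residual.EvenBranch.cycWindingNonConstantAt_of_odd W p hp2 hgood hirr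
  have h := hnc f hf
  obtain ⟨n, u, hu⟩ := exists_unit_norm_ratPlusSymbol_eq_one_of_nonConstant f hp2 hf.1 hf.coeffField_eq_bot hpN hap'
    (by exact_mod_cast h)
  obtain ⟨s, i, hi, hieven, h1⟩ :=
    exists_even_weightedOrbitSum_norm_eq_one_of_unit f hp2 hf.1 hpN hap' u (by exact_mod_cast hu)
  exact ⟨n, s, i, hi, hieven, h1⟩

/-! ## §3 The weight `i = 0` IS the stub's certificate; the dichotomy per newform -/

/-- **A unit weight-`0` orbit sum gives a signed Pollack function with unit content** (`W/ℚ` globally minimal, good at the odd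
prime `p`, `a_p = 0`, newform `f`): the weight-`0` sum at `(n+1, γˢ)` is the Teichmüller orbit sum `S_f(p, n+1, γˢ)`
(`teichOrbitSum_eq_finsum`), `γˢ` is a unit, and a unit orbit sum forces `∃ ε L, IsSignedPAdicLFunction f p ε L ∧ HasUnitContent L`
(`SmallImageTeichSpanHecke.exists_sign_hasUnitContent_of_one_le_norm_teichOrbitSum`).
[cite: MazurTateTeitelbaum1986Invent, §I.10 (10.1)] [cite: Pollack2003, Def. 6.15 and Remark 6.16] [cite: PollackWeston2011, Thm. 4.1 (1)] -/
theorem exists_sign_hasUnitContent_of_weightZero {W : WeierstrassCurve ℚ} [W.IsElliptic] [W.IsGloballyMinimal]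
    (hp2 : p ≠ 2) (hf : IsNewformOf W f) (hgood : W.HasGoodReductionAtPrime p) (hap : W.frobeniusTrace p = 0)
    {n : ℕ} (s : ZMod (p ^ n))
    (h0 : ‖∑ᶠ ξ : rootsOfUnity (torsionOrder p) ℤ_[p],
        ((ratPlusSymbol f ((((PadicInt.toZModPow (n + 1) ((ξ : ℤ_[p]ˣ) : ℤ_[p]) *
          (cyclotomicGenerator p : ZMod (p ^ (n + 1))) ^ s.val).val : ℕ) : ℚ) / (p : ℚ) ^ (n + 1)) : ℚ) : ℚ_[p])‖ = 1) :
    ∃ (ε : ℤˣ) (L : IwasawaAlgebra p), IsSignedPAdicLFunction f p ε L ∧ HasUnitContent L := by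
  classical
  haveI := neZero_torsionOrder p
  haveI := Fintype.ofFinite (rootsOfUnity (torsionOrder p) ℤ_[p])
  -- `γˢ` is a unit of `ℤ/p^{n+1}`
  obtain ⟨b, hb⟩ : ∃ b : (ZMod (p ^ (n + 1)))ˣ,
      (b : ZMod (p ^ (n + 1))) = (cyclotomicGenerator p : ZMod (p ^ (n + 1))) ^ s.val :=
    ⟨((isUnit_cyclotomicGenerator_cast (p := p) (n + 1)).pow s.val).unit, IsUnit.unit_spec _⟩
  -- the weight-`0` sum is `S_f(p, n+1, γˢ)`
  have hT : ((teichOrbitSum f p (n + 1) (b : ZMod (p ^ (n + 1))) : ℚ) : ℚ_[p]) =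
      ∑ᶠ ξ : rootsOfUnity (torsionOrder p) ℤ_[p],
        ((ratPlusSymbol f ((((PadicInt.toZModPow (n + 1) ((ξ : ℤ_[p]ˣ) : ℤ_[p]) *
          (cyclotomicGenerator p : ZMod (p ^ (n + 1))) ^ s.val).val : ℕ) : ℚ) / (p : ℚ) ^ (n + 1)) : ℚ) : ℚ_[p]) := by
    rw [hb, teichOrbitSum_eq_finsum f hp2 (by omega), finsum_eq_sum_of_fintype, finsum_eq_sum_of_fintype]
    push_cast
    rfl
  refine exists_sign_hasUnitContent_of_one_le_norm_teichOrbitSum f hp2 hf hgood hap ⟨n + 1, by omega, b, ?_⟩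
  rw [hT, h0]

/-- **THE DICHOTOMY per newform** (`W/ℚ` globally minimal, good supersingular at the odd prime `p`, `a_p = 0`, newform `f`):
EITHER one of Pollack's signed `p`-adic `L`-functions of `f` has unit content (`min(μ(L_p⁺), μ(L_p⁻)) = 0` — the conclusion of
`stub_muAnOneSignGeFive_ns` / retired 23117 at this pair) OR some NON-TRIVIAL even weight `0 < i < p − 1` carries a unit weighted
Teichmüller orbit sum (`μ(θ_n(f, ω^i)) = 0` on a non-trivial even branch).  Input-free (§2 + §3).
[cite: MazurTateTeitelbaum1986Invent, §I.13] [cite: PollackWeston2011, Thm. 4.1 (1), Rem. 4.2] -/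
theorem exists_sign_hasUnitContent_or_pos_even_branch {W : WeierstrassCurve ℚ} [W.IsElliptic] [W.IsGloballyMinimal]
    (hp2 : p ≠ 2) (hf : IsNewformOf W f) (hgood : W.HasGoodReductionAtPrime p) (hap : W.frobeniusTrace p = 0) :
    (∃ (ε : ℤˣ) (L : IwasawaAlgebra p), IsSignedPAdicLFunction f p ε L ∧ HasUnitContent L) ∨
      ∃ (n : ℕ) (s : ZMod (p ^ n)) (i : ℕ), 0 < i ∧ i < p - 1 ∧ Even i ∧
        ‖∑ᶠ ξ : rootsOfUnity (torsionOrder p) ℤ_[p], (((ξ : ℤ_[p]ˣ) : ℤ_[p]) : ℚ_[p]) ^ i *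
          ((ratPlusSymbol f ((((PadicInt.toZModPow (n + 1) ((ξ : ℤ_[p]ˣ) : ℤ_[p]) *
            (cyclotomicGenerator p : ZMod (p ^ (n + 1))) ^ s.val).val : ℕ) : ℚ) / (p : ℚ) ^ (n + 1)) : ℚ) : ℚ_[p])‖ = 1 := by
  obtain ⟨n, s, i, hi, hieven, h1⟩ := exists_even_weightedOrbitSum_norm_eq_one_of_isNewformOf f hp2 hf hgood hap
  rcases Nat.eq_zero_or_pos i with rfl | hpos
  · left
    refine exists_sign_hasUnitContent_of_weightZero f hp2 hf hgood hap s ?_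
    simpa only [pow_zero, one_mul] using h1
  · right
    exact ⟨n, s, i, hpos, hi, hieven, h1⟩

/-- **`p = 5`: `ω⁰ ∨ ω²`.**  For `W/ℚ` globally minimal with good supersingular reduction at `5` (`a₅ = 0`) and its newform `f`:
EITHER a signed `5`-adic `L`-function of `f` has unit content OR the `η²`-weighted orbit sum (`ω² = (5/·)`, the branch whose values
are those of the quadratic twist by `ℚ(√5)`) is a unit at some level.  The only even weights `< 4` are `0` and `2`.
[cite: MazurTateTeitelbaum1986Invent, §I.13] [cite: PollackWeston2011, Rem. 4.2] -/
theorem exists_sign_hasUnitContent_or_weightTwo_five {W : WeierstrassCurve ℚ} [W.IsElliptic] [W.IsGloballyMinimal]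
    (hp : p = 5) (hf : IsNewformOf W f) (hgood : W.HasGoodReductionAtPrime p) (hap : W.frobeniusTrace p = 0) :
    (∃ (ε : ℤˣ) (L : IwasawaAlgebra p), IsSignedPAdicLFunction f p ε L ∧ HasUnitContent L) ∨
      ∃ (n : ℕ) (s : ZMod (p ^ n)),
        ‖∑ᶠ ξ : rootsOfUnity (torsionOrder p) ℤ_[p], (((ξ : ℤ_[p]ˣ) : ℤ_[p]) : ℚ_[p]) ^ 2 *
          ((ratPlusSymbol f ((((PadicInt.toZModPow (n + 1) ((ξ : ℤ_[p]ˣ) : ℤ_[p]) *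
            (cyclotomicGenerator p : ZMod (p ^ (n + 1))) ^ s.val).val : ℕ) : ℚ) / (p : ℚ) ^ (n + 1)) : ℚ) : ℚ_[p])‖ = 1 := by
  rcases exists_sign_hasUnitContent_or_pos_even_branch f (by omega) hf hgood hap with h | ⟨n, s, i, hpos, hi, hieven, h1⟩
  · exact Or.inl h
  · right
    obtain ⟨k, rfl⟩ := hieven
    have hk : k = 1 := by omega
    subst hk
    exact ⟨n, s, h1⟩

/-- **`p = 7`: `ω⁰ ∨ ω² ∨ ω⁴`** (good supersingular at `7`, `a₇ = 0`): EITHER unit content for one sign OR a unit `η²`- or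
`η⁴`-weighted orbit sum at some level.  [cite: MazurTateTeitelbaum1986Invent, §I.13] [cite: PollackWeston2011, Rem. 4.2] -/
theorem exists_sign_hasUnitContent_or_weightTwoFour_seven {W : WeierstrassCurve ℚ} [W.IsElliptic] [W.IsGloballyMinimal]
    (hp : p = 7) (hf : IsNewformOf W f) (hgood : W.HasGoodReductionAtPrime p) (hap : W.frobeniusTrace p = 0) :
    (∃ (ε : ℤˣ) (L : IwasawaAlgebra p), IsSignedPAdicLFunction f p ε L ∧ HasUnitContent L) ∨
      ∃ (n : ℕ) (s : ZMod (p ^ n)) (i : ℕ), (i = 2 ∨ i = 4) ∧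
        ‖∑ᶠ ξ : rootsOfUnity (torsionOrder p) ℤ_[p], (((ξ : ℤ_[p]ˣ) : ℤ_[p]) : ℚ_[p]) ^ i *
          ((ratPlusSymbol f ((((PadicInt.toZModPow (n + 1) ((ξ : ℤ_[p]ˣ) : ℤ_[p]) *
            (cyclotomicGenerator p : ZMod (p ^ (n + 1))) ^ s.val).val : ℕ) : ℚ) / (p : ℚ) ^ (n + 1)) : ℚ) : ℚ_[p])‖ = 1 := by
  rcases exists_sign_hasUnitContent_or_pos_even_branch f (by omega) hf hgood hap with h | ⟨n, s, i, hpos, hi, hieven, h1⟩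
  · exact Or.inl h
  · right
    obtain ⟨k, rfl⟩ := hieven
    exact ⟨n, s, k + k, by omega, h1⟩

/-- **`p = 11`: `ω⁰ ∨ ω² ∨ ω⁴ ∨ ω⁶ ∨ ω⁸`** (good supersingular at `11`, `a₁₁ = 0`).
[cite: MazurTateTeitelbaum1986Invent, §I.13] [cite: PollackWeston2011, Rem. 4.2] -/
theorem exists_sign_hasUnitContent_or_weight_eleven {W : WeierstrassCurve ℚ} [W.IsElliptic] [W.IsGloballyMinimal]
    (hp : p = 11) (hf : IsNewformOf W f) (hgood : W.HasGoodReductionAtPrime p) (hap : W.frobeniusTrace p = 0) :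
    (∃ (ε : ℤˣ) (L : IwasawaAlgebra p), IsSignedPAdicLFunction f p ε L ∧ HasUnitContent L) ∨
      ∃ (n : ℕ) (s : ZMod (p ^ n)) (i : ℕ), (i = 2 ∨ i = 4 ∨ i = 6 ∨ i = 8) ∧
        ‖∑ᶠ ξ : rootsOfUnity (torsionOrder p) ℤ_[p], (((ξ : ℤ_[p]ˣ) : ℤ_[p]) : ℚ_[p]) ^ i *
          ((ratPlusSymbol f ((((PadicInt.toZModPow (n + 1) ((ξ : ℤ_[p]ˣ) : ℤ_[p]) *
            (cyclotomicGenerator p : ZMod (p ^ (n + 1))) ^ s.val).val : ℕ) : ℚ) / (p : ℚ) ^ (n + 1)) : ℚ) : ℚ_[p])‖ = 1 := by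
  rcases exists_sign_hasUnitContent_or_pos_even_branch f (by omega) hf hgood hap with h | ⟨n, s, i, hpos, hi, hieven, h1⟩
  · exact Or.inl h
  · right
    obtain ⟨k, rfl⟩ := hieven
    exact ⟨n, s, k + k, by omega, h1⟩

/-! ## §4 Class level: the {5, 7, 11} cut -/

section Cut

/-- **The registered stub `stub_muAnOneSignGeFive_ns` (= retired 23117 `SmallImageOneSignUnitContent`, VERBATIM text) ⟺ its
`p ≤ 11` cut**, GRANTED BDMTV 2019 Cor. 1.3 / 2023 Thm. 1.2 (`h13`, `h17`: the `ℚ`-points of `X_ns⁺(13)`, `X_ns⁺(17)` are CM —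
PUBLISHED, by name) and the non-split half of Serre's uniformity question at every prime `p ≥ 19` (`h19`, OPEN, expected).
PRINT-FREE (the M-version `SmallImageMuZeroOneSignOfFacts` §2 needs the five prints; the stub itself needs none): at `13`, `17` and
`≥ 19` the stub's domain is EMPTY (route-independent kernel `GaloisImage.hasNonsplitCartanModPImage_of_goodSS_of_not_surj`: good
supersingular + not surjective ⇒ image in the normaliser of a non-split Cartan ⇒ CM by `hU` ⇒ contradiction with `¬CM`).  So modulo
BDMTV and Serre uniformity the open stub of line `birth_mu` is EXACTLY «at every small-image X7 pair with `p ∈ {5, 7, 11}`, for the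
conductor-level newform SOME sign has a signed `p`-adic `L`-function with a unit coefficient».  Stated on the stub's TEXT (left side =
the registered signature verbatim, so `theorem … : SmallImageOneSignUnitContent ↔ … := stub_iff_le_eleven h13 h17 h19` type-checks by
unfolding in any Theses-side consumer); this file stays route-independent.  Closes nothing.
[cite: BalakrishnanEtAl2019, Cor. 1.3] [cite: BalakrishnanEtAl2023, Thm. 1.2] [cite: SerreKyoto1977, questions 6.5–6.6, pp. 187–188]
[cite: Pollack2003, Conj. 6.3 (p. 548)] -/
theorem stub_iff_le_eleven
    (h13 : Literature.NumberTheory.SerreUniformity.BDMTV2019_nonsplitCartan_level13)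
    (h17 : Literature.NumberTheory.SerreUniformity.BDMTV2023_nonsplitCartan_level17)
    (h19 : ∀ (q : ℕ), q.Prime → 19 ≤ q → Literature.NumberTheory.SerreUniformity.NonsplitCartanPointsAreCM q) :
    (∀ (W : WeierstrassCurve ℚ) [W.IsElliptic] [W.IsGloballyMinimal] (p : ℕ) [Fact p.Prime],
        5 ≤ p → ClassX7 W p → ¬ W.HasCM → W.frobeniusTrace p = 0 → ¬ Surj W p →
        ∀ [NeZero (W.conductorNorm ℤ)] (f : CuspForm (Gamma0 (W.conductorNorm ℤ)) 2),
          IsNewformOf W f → ∃ (ε₀ : ℤˣ) (L₀ : IwasawaAlgebra p), IsSignedPAdicLFunction f p ε₀ L₀ ∧ HasUnitContent L₀) ↔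
      ∀ (W : WeierstrassCurve ℚ) [W.IsElliptic] [W.IsGloballyMinimal] (p : ℕ) [Fact p.Prime],
        5 ≤ p → p ≤ 11 → ClassX7 W p → ¬ W.HasCM → W.frobeniusTrace p = 0 → ¬ Surj W p →
        ∀ [NeZero (W.conductorNorm ℤ)] (f : CuspForm (Gamma0 (W.conductorNorm ℤ)) 2),
          IsNewformOf W f → ∃ (ε₀ : ℤˣ) (L₀ : IwasawaAlgebra p), IsSignedPAdicLFunction f p ε₀ L₀ ∧ HasUnitContent L₀ := by
  constructor
  · intro h W _ _ p _ hp5 _ hX hCM hap hs _ f hf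
    exact h W p hp5 hX hCM hap hs f hf
  · intro h5711 W _ _ p hpP hp5 hX hCM hap hs _ f hf
    have hpr : p.Prime := hpP.out
    have hp2 : p ≠ 2 := by omega
    by_cases h11 : p ≤ 11
    · exact h5711 W p hp5 h11 hX hCM hap hs f hf
    -- `12 ≤ p`: the domain is EMPTY once `X_ns⁺(p)(ℚ)` is CM
    have hempty : Literature.NumberTheory.SerreUniformity.NonsplitCartanPointsAreCM p → False := fun hU ↦
      hCM (hU W (Summit.BirchSwinnertonDyer.Rank1Residual.GaloisImage.hasNonsplitCartanModPImage_of_goodSS_of_not_surj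
        W p hp2 hX.1 hs))
    by_cases h19p : 19 ≤ p
    · exact (hempty (h19 p hpr h19p)).elim
    · have h1317 : p = 13 ∨ p = 17 := by
        interval_cases p <;> first | (left; rfl) | (right; rfl) | exact absurd hpr (by decide)
      rcases h1317 with rfl | rfl
      · exact (hempty h13).elim
      · exact (hempty h17).elim

/-- **The {5, 7, 11} cut ⟸ one unit `ω⁰`-orbit sum per pair** (Conjecture-W shape, decidable per pair by finitely many exact modular
symbols): if at every small-image X7 pair with `5 ≤ p ≤ 11` the conductor-level newform has SOME Teichmüller orbit sum
`S_f(p, n, b)` (`n ≥ 1`, `b` a unit) of `p`-adic norm `≥ 1`, the cut holds.  (`SmallImageTeichSpanHecke.exists_sign_hasUnitContent_of_one_le_norm_teichOrbitSum`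
pair by pair; the class hypotheses are passed through unused.) [cite: MazurTateTeitelbaum1986Invent, §I.10 (10.1)] [cite: PollackWeston2011, Thm. 4.1 (1)] -/
theorem cut_of_orbitUnit
    (hW : ∀ (W : WeierstrassCurve ℚ) [W.IsElliptic] [W.IsGloballyMinimal] (p : ℕ) [Fact p.Prime],
      5 ≤ p → p ≤ 11 → ClassX7 W p → ¬ W.HasCM → W.frobeniusTrace p = 0 → ¬ Surj W p →
      ∀ [NeZero (W.conductorNorm ℤ)] (f : CuspForm (Gamma0 (W.conductorNorm ℤ)) 2), IsNewformOf W f →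
        ∃ n : ℕ, 1 ≤ n ∧ ∃ b : (ZMod (p ^ n))ˣ, 1 ≤ ‖((teichOrbitSum f p n (b : ZMod (p ^ n)) : ℚ) : ℚ_[p])‖) :
    ∀ (W : WeierstrassCurve ℚ) [W.IsElliptic] [W.IsGloballyMinimal] (p : ℕ) [Fact p.Prime],
      5 ≤ p → p ≤ 11 → ClassX7 W p → ¬ W.HasCM → W.frobeniusTrace p = 0 → ¬ Surj W p →
      ∀ [NeZero (W.conductorNorm ℤ)] (f : CuspForm (Gamma0 (W.conductorNorm ℤ)) 2),
        IsNewformOf W f → ∃ (ε₀ : ℤˣ) (L₀ : IwasawaAlgebra p), IsSignedPAdicLFunction f p ε₀ L₀ ∧ HasUnitContent L₀ := by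
  intro W _ _ p _ hp5 h11 hX hCM hap hs _ f hf
  exact exists_sign_hasUnitContent_of_one_le_norm_teichOrbitSum f (by omega) hf hX.1.1 hap
    (hW W p hp5 h11 hX hCM hap hs f hf)

/-- **At every pair of the cut's domain the dichotomy holds UNCONDITIONALLY**: for a small-image X7 pair `(W, p)` with `5 ≤ p`
(hence good supersingular, `a_p = 0`) and its conductor-level newform `f`, EITHER the stub's conclusion holds at the pair OR a
non-trivial even weight `0 < i < p − 1` carries a unit weighted orbit sum.  So the cut's residual, in branch currency, is «no pair at
`p ∈ {5, 7, 11}` has its unit orbit content on the non-trivial even branches only» (at `p = 5`: on `ω²` only).  The class hypotheses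
`¬CM`, `¬Surj`, `5 ≤ p` are idle (only «good at `p`», `a_p = 0`, `p` odd are used).
[cite: MazurTateTeitelbaum1986Invent, §I.13] [cite: PollackWeston2011, Rem. 4.2] -/
theorem cut_or_pos_even_branch (W : WeierstrassCurve ℚ) [W.IsElliptic] [W.IsGloballyMinimal] (p : ℕ) [Fact p.Prime]
    (hp5 : 5 ≤ p) (hX : ClassX7 W p) (hap : W.frobeniusTrace p = 0)
    [NeZero (W.conductorNorm ℤ)] (f : CuspForm (Gamma0 (W.conductorNorm ℤ)) 2) (hf : IsNewformOf W f) :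
    (∃ (ε₀ : ℤˣ) (L₀ : IwasawaAlgebra p), IsSignedPAdicLFunction f p ε₀ L₀ ∧ HasUnitContent L₀) ∨
      ∃ (n : ℕ) (s : ZMod (p ^ n)) (i : ℕ), 0 < i ∧ i < p - 1 ∧ Even i ∧
        ‖∑ᶠ ξ : rootsOfUnity (torsionOrder p) ℤ_[p], (((ξ : ℤ_[p]ˣ) : ℤ_[p]) : ℚ_[p]) ^ i *
          ((ratPlusSymbol f ((((PadicInt.toZModPow (n + 1) ((ξ : ℤ_[p]ˣ) : ℤ_[p]) *
            (cyclotomicGenerator p : ZMod (p ^ (n + 1))) ^ s.val).val : ℕ) : ℚ) / (p : ℚ) ^ (n + 1)) : ℚ) : ℚ_[p])‖ = 1 :=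
  exists_sign_hasUnitContent_or_pos_even_branch f (by omega) hf hX.1.1 hap

end Cut

end Summit.BirchSwinnertonDyer.BirchSwinnertonDyer.Theorems.SmallImageMuAnEvenBranch

end
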